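import Summits.CriticalPhenomena.Ising3D.Control2DCellCheck2
import Summits.CriticalPhenomena.Ising3D.Control2DEps102Cuts2
import Summits.CriticalPhenomena.Ising3D.Control2DCertificateEps102
import HarnessLib

/-!
# The 2D control: obligation (C) of certificate `eps102` IN THE KERNEL (second-order scheme) — file A
(cell `pub-ising3x`, seat controls-1; kernel runs of `Control2DCellCheck2.checkSpin2`)

HONEST FRAMING: lottery ticket; floor = tightest certified 3D Ising CFT bounds; no exact-solution claim without a proof.

Kernel evaluations (`decide +kernel`; no `native_decide`, no extra axioms) of the second-order (C)
checker at `P = 80` on the data of certificate `eps102`, one per cut list of `Control2DEps102Cuts2.lean`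
(chunks `c2cuts0a`, `c2cuts0b`; estimated kernel time of this file ≈ 95 s).
-/

namespace Summit.CriticalPhenomena.Ising3D.Control2D.RB0

open Set
open Literature.MathematicalPhysics.QuantumFieldTheory.ConformalBootstrap3D
open Summit.CriticalPhenomena.Ising3D.Control2D

set_option maxHeartbeats 10000000 in
set_option maxRecDepth 200000 in
/-- (C) of `eps102`, spin `0`, cells of `eps102_c2cuts0a` (`15` cells, `N = 96`, depth `15`,
left stencil `8355/8192`, extra `263/256`). [folklore] -/
theorem eps102_check2_c2cuts0a :
    checkSpin2 80 96 0 (eps105_vals.map (NI.ofRat 80)) (mkCData 80 15 0 eps105_vals eps102_w eps1005_z eps1005_zb)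
      true (8355/8192) eps102_c2cuts0a (263/256) = true := by
  decide +kernel

set_option maxHeartbeats 10000000 in
set_option maxRecDepth 200000 in
/-- (C) of `eps102`, spin `0`, cells of `eps102_c2cuts0b` (`49` cells, `N = 72`, depth `16`,
left stencil `4191/4096`, extra `83/64`). [folklore] -/
theorem eps102_check2_c2cuts0b :
    checkSpin2 80 72 0 (eps105_vals.map (NI.ofRat 80)) (mkCData 80 16 0 eps105_vals eps102_w eps1005_z eps1005_zb)
      true (4191/4096) eps102_c2cuts0b (83/64) = true := by
  decide +kernel

end Summit.CriticalPhenomena.Ising3D.Control2D.RB0
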